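import Mathlib.Analysis.Convex.PathConnected
import Mathlib.Analysis.Convex.Topology
import Mathlib.Analysis.Normed.Affine.AddTorsor
import Mathlib.Algebra.Order.Floor.Defs
import Literature.Geometry.Lorentzian.Basic
import HarnessLib

/-!
# Crux `GapExhaustion` (stmt-FinalStateConjecture-10808), line `photon-shell-pseudoconvexity`:
# stub `stub_levelSweepDense` — the abstract level-set sweep WITHOUT convex sublevel sets
# (density of `{f < c}` at the level points only)

Route `BartnikGapSettling`; helper (`--supports stmt-FinalStateConjecture-10808`) of the line's
rigidity node. The sibling file `BartnikGapSettlingGapExhaustionLevelSweep` proves the abstract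
level-set sweep `stub_levelSweep` (a field admissible on `D ∩ {f < c₀}` extends to one admissible
on `D ∩ {f < c₁}` under a uniform local extension property across the levels `c ∈ [c₀, c₁]`),
which serves the OUTWARD sweep (S5) with `f = r` the Kerr–Schild radius, whose sublevel sets are
solid ellipsoids, hence convex. The INWARD sweep (S3) runs with `f = −r`, whose sublevel sets
`{r ≥ c}` are not convex, so the tool must lose convexity. In `stub_levelSweep` convexity of
`{f ≤ c}` (together with `{f ≤ c} ⊆ closure {f < c}`) is used at exactly one place: to see that
the lens `ball x ρ' ∩ ball x' ρ'` of two local extensions at level points `x, x'` meets `{f < c}`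
(via the midpoint of `x, x'`). This file removes both hypotheses in favour of the single, local
one `f x = c → x ∈ closure {f < c}` (density of the strict sublevel set AT the level points), by
gluing the local extensions on the HALF-radius balls `ball x (ρ'/2)`: agreement is then only
needed for pairs of level points at distance `< ρ'`, and for such a pair the centre `x'` itself
lies in the big lens `V = ball x ρ' ∩ ball x' ρ'` (open, convex hence connected) and in
`closure {f < c}`, so `V ∩ {f < c}` is a nonempty open subset of `V` on which both extensions
equal the old field; unique continuation gives agreement on `V ⊇ ball x (ρ'/2) ∩ ball x' (ρ'/2)`.
The glued field is admissible on the old region and on every half-ball (restriction + locality),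
hence on their union (gluing), which contains `D ∩ {f < c + ρ'/(4C)}` by the linear covering
estimate (a point `y` above the level is within `C (f y − c) < ρ'/4` of a level point). Then
induct on `⌊(c₁ − c₀)/σ⌋ + 1` steps of size `σ = ρ'/(4C)`. Pure topology over `E4`; no
geometry is used. [folklore globalisation argument; cf. Alexakis–Ionescu–Klainerman,
CMP 299 (2010), §6]
-/

noncomputable section

-- D-0017: single-problem summit, `Summit.<S>.<S>.…` by design (cf. lakefile `weak.linter.dupNamespace`).
set_option linter.dupNamespace false

namespace Summit.FinalStateConjecture.FinalStateConjecture.Theorems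

open Set Metric
open Literature.Geometry.Lorentzian

/-- **One step of the level-set sweep, without convexity.** Under the four axioms on `P`
(restriction, locality, gluing over open covers, unique continuation on connected opens), the two
geometric hypotheses on `f` at the level `c` (every level point `f x = c` lies in
`closure {f < c}`; linear covering estimate above `c` inside the arena `D`), and the uniform local
extension property across `{f = c}` (input radius `ρ`, output radius `ρ'`, the `ρ`-balls around
level points lying in `D`), a field admissible on `D ∩ {f < c}` extends to a field admissible on
`D ∩ {f < c + ρ'/(4C)}` agreeing with it on `D ∩ {f < c}`. The local extensions are glued on the
half-radius balls `ball x (ρ'/2)`, two of which only meet when `dist x x' < ρ'`, in which case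
`x' ∈ ball x ρ' ∩ ball x' ρ'` witnesses (by density at `x'`) that this connected lens meets
`{f < c}`, where unique continuation applies (cf. Alexakis–Ionescu–Klainerman, CMP 299 (2010),
§6). [folklore] -/
theorem levelSweepDense_step (β : Type) (P : (E4 → β) → Set E4 → Prop) (f : E4 → ℝ)
    (D : Set E4) (c ρ ρ' C : ℝ)
    (hmono : ∀ (k : E4 → β) (U V : Set E4), P k U → V ⊆ U → P k V)
    (hcongr : ∀ (k k' : E4 → β) (U : Set E4), IsOpen U → EqOn k k' U → P k U → P k' U)
    (hunion : ∀ (k : E4 → β) (ι : Type) (U : ι → Set E4), (∀ i, IsOpen (U i)) →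
      (∀ i, P k (U i)) → P k (⋃ i, U i))
    (hpatch : ∀ (k₁ k₂ : E4 → β) (U V : Set E4), IsOpen V → IsConnected V → IsOpen U → U ⊆ V →
      U.Nonempty → P k₁ V → P k₂ V → EqOn k₁ k₂ U → EqOn k₁ k₂ V)
    (hf : Continuous f) (hD : IsOpen D) (hρ' : 0 < ρ') (hC : 0 < C)
    (hdense : ∀ x, f x = c → x ∈ closure {y | f y < c})
    (hcover : ∀ y ∈ D, c ≤ f y → ∃ x, f x = c ∧ ‖x - y‖ ≤ C * (f y - c))
    (hball : ∀ x, f x = c → ball x ρ ⊆ D)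
    (hloc : ∀ x, f x = c → ∀ k : E4 → β, P k (ball x ρ ∩ {y | f y < c}) →
      ∃ k' : E4 → β, P k' (ball x ρ') ∧ EqOn k' k (ball x ρ' ∩ {y | f y < c}))
    (k : E4 → β) (hk : P k (D ∩ {y | f y < c})) :
    ∃ k' : E4 → β, P k' (D ∩ {y | f y < c + ρ' / (4 * C)}) ∧ EqOn k' k (D ∩ {y | f y < c}) := by
  have hlt : IsOpen {y : E4 | f y < c} := isOpen_lt hf continuous_const
  -- local extensions at every level point
  have hloc' : ∀ x : {x : E4 // f x = c}, ∃ k' : E4 → β, P k' (ball x.1 ρ') ∧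
      EqOn k' k (ball x.1 ρ' ∩ {y | f y < c}) := fun x ↦
    hloc x.1 x.2 k (hmono k _ _ hk fun y hy ↦ ⟨hball x.1 x.2 hy.1, hy.2⟩)
  choose kx hkxP hkxeq using hloc'
  -- two local extensions at centres closer than `ρ'` agree on the lens of their `ρ'`-balls
  have hpair : ∀ x x' : {x : E4 // f x = c}, dist x.1 x'.1 < ρ' →
      EqOn (kx x) (kx x') (ball x.1 ρ' ∩ ball x'.1 ρ') := by
    intro x x' hxx'
    set V : Set E4 := ball x.1 ρ' ∩ ball x'.1 ρ' with hV
    -- the centre `x'` lies in the lens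
    have hx'V : x'.1 ∈ V := ⟨mem_ball'.2 hxx', mem_ball_self hρ'⟩
    have hVo : IsOpen V := isOpen_ball.inter isOpen_ball
    have hVc : IsConnected V :=
      ((convex_ball x.1 ρ').inter (convex_ball x'.1 ρ')).isConnected ⟨x'.1, hx'V⟩
    -- and in `closure {f < c}`, hence the lens meets `{f < c}`
    have hUne : (V ∩ {y | f y < c}).Nonempty := by
      obtain ⟨y, hyV, hy⟩ := mem_closure_iff.1 (hdense x'.1 x'.2) V hVo hx'V
      exact ⟨y, hyV, hy⟩
    refine hpatch (kx x) (kx x') (V ∩ {y | f y < c}) V hVo hVc (hVo.inter hlt) inter_subset_left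
      hUne (hmono _ _ _ (hkxP x) inter_subset_left) (hmono _ _ _ (hkxP x') inter_subset_right) ?_
    intro y hy
    rw [hkxeq x ⟨hy.1.1, hy.2⟩, hkxeq x' ⟨hy.1.2, hy.2⟩]
  -- the glued field, on the HALF-radius balls
  classical
  let k' : E4 → β := fun y ↦
    if h : ∃ x : {x : E4 // f x = c}, y ∈ ball x.1 (ρ' / 2) then kx h.choose y else k y
  have hhalf : ∀ x : {x : E4 // f x = c}, ball x.1 (ρ' / 2) ⊆ ball x.1 ρ' := fun x ↦
    ball_subset_ball (by linarith)
  have hk'ball : ∀ x : {x : E4 // f x = c}, EqOn k' (kx x) (ball x.1 (ρ' / 2)) := by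
    intro x y hy
    have h : ∃ x : {x : E4 // f x = c}, y ∈ ball x.1 (ρ' / 2) := ⟨x, hy⟩
    simp only [k', dif_pos h]
    -- the two half-balls meet at `y`, so their centres are closer than `ρ'`
    have hd : dist h.choose.1 x.1 < ρ' := by
      have h1 : dist y h.choose.1 < ρ' / 2 := mem_ball.1 h.choose_spec
      have h2 : dist y x.1 < ρ' / 2 := mem_ball.1 hy
      calc dist h.choose.1 x.1 ≤ dist h.choose.1 y + dist y x.1 := dist_triangle _ _ _
        _ < ρ' / 2 + ρ' / 2 := add_lt_add (by rwa [dist_comm]) h2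
        _ = ρ' := by ring
    exact hpair h.choose x hd ⟨hhalf _ h.choose_spec, hhalf _ hy⟩
  have hk'old : EqOn k' k {y | f y < c} := by
    intro y hy
    by_cases h : ∃ x : {x : E4 // f x = c}, y ∈ ball x.1 (ρ' / 2)
    · simp only [k', dif_pos h]
      exact hkxeq h.choose ⟨hhalf _ h.choose_spec, hy⟩
    · simp only [k', dif_neg h]
  -- admissibility of the glued field on the old region and on every half-ball, hence on the union
  have hP₁ : P k' (D ∩ {y | f y < c}) :=
    hcongr k k' _ (hD.inter hlt) (fun y hy ↦ (hk'old hy.2).symm) hk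
  have hP₂ : ∀ x : {x : E4 // f x = c}, P k' (ball x.1 (ρ' / 2)) := fun x ↦
    hcongr (kx x) k' _ isOpen_ball (fun y hy ↦ (hk'ball x hy).symm)
      (hmono _ _ _ (hkxP x) (hhalf x))
  let U : Option {x : E4 // f x = c} → Set E4 := fun o ↦
    match o with
    | none => D ∩ {y | f y < c}
    | some x => ball x.1 (ρ' / 2)
  have hUopen : ∀ o, IsOpen (U o) := by
    rintro (_ | x)
    · exact hD.inter hlt
    · exact isOpen_ball
  have hUP : ∀ o, P k' (U o) := by
    rintro (_ | x)
    · exact hP₁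
    · exact hP₂ x
  have hPU : P k' (⋃ o, U o) := hunion k' _ U hUopen hUP
  -- the union contains the next sublevel region
  have hsub : D ∩ {y | f y < c + ρ' / (4 * C)} ⊆ ⋃ o, U o := by
    intro y hy
    rcases lt_or_ge (f y) c with hlt' | hge
    · exact mem_iUnion.2 ⟨none, hy.1, hlt'⟩
    · obtain ⟨x, hx, hxy⟩ := hcover y hy.1 hge
      refine mem_iUnion.2 ⟨some ⟨x, hx⟩, ?_⟩
      show y ∈ ball x (ρ' / 2)
      rw [mem_ball, dist_comm, dist_eq_norm]
      have h0 : f y < c + ρ' / (4 * C) := hy.2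
      have h1 : f y - c < ρ' / (4 * C) := by linarith
      have h2 : C * (f y - c) < C * (ρ' / (4 * C)) := mul_lt_mul_of_pos_left h1 hC
      have h3 : C * (ρ' / (4 * C)) = ρ' / 4 := by field_simp
      linarith
  exact ⟨k', hmono _ _ _ hPU hsub, fun y hy ↦ hk'old hy.2⟩

/-- **Stub `stub_levelSweepDense` of the line `photon-shell-pseudoconvexity` (crux
`GapExhaustion`, stmt-FinalStateConjecture-10808) — the abstract level-set sweep with density
only at the level points and no convexity.** Let `P k U` be a predicate on fields `k : E4 → β`
and sets `U ⊆ E4` which is monotone under restriction, local (invariant under changing `k` off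
the open set `U`), glues over arbitrary open covers, and has unique continuation on connected
open sets (two `P`-fields on a connected open `V` agreeing on a nonempty open `U ⊆ V` agree on
`V`). Let `f` be continuous such that, for `c ∈ [c₀, c₁]`, every level point `f x = c` lies in
`closure {f < c}`; let `D` be an open arena in which every point `y` above level `c` is within
`C (f y − c)` of the level set `{f = c}`; and suppose the UNIFORM LOCAL EXTENSION property
across every level `c ∈ [c₀, c₁]`: for every `x` with `f x = c`, `ball x ρ ⊆ D`, and every
`P`-field on the half-ball `ball x ρ ∩ {f < c}` is extended by a `P`-field on `ball x ρ'`
(`0 < ρ'`) agreeing with it on `ball x ρ' ∩ {f < c}`. Then every `P`-field on `D ∩ {f < c₀}` is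
extended by a `P`-field on `D ∩ {f < c₁}`. This is the convexity-free form of `stub_levelSweep`
needed by the INWARD sweep S3 (`f = −r`, non-convex sublevel sets `{r ≥ c}`); it is the
topological half of the globalisation of the Ionescu–Klainerman local Killing-extension theorems
over the foliation by Kerr–Schild cylinders (cf. Alexakis–Ionescu–Klainerman, CMP 299 (2010),
§6). Proof: `⌊(c₁ − c₀)/σ⌋ + 1` applications of `levelSweepDense_step`, `σ = ρ'/(4C)`.
[folklore] -/
theorem stub_levelSweepDense :
    ∀ (β : Type) (P : (E4 → β) → Set E4 → Prop) (f : E4 → ℝ) (D : Set E4) (c₀ c₁ ρ ρ' C : ℝ)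
      (k₀ : E4 → β),
      (∀ (k : E4 → β) (U V : Set E4), P k U → V ⊆ U → P k V) →
      (∀ (k k' : E4 → β) (U : Set E4), IsOpen U → EqOn k k' U → P k U → P k' U) →
      (∀ (k : E4 → β) (ι : Type) (U : ι → Set E4), (∀ i, IsOpen (U i)) →
        (∀ i, P k (U i)) → P k (⋃ i, U i)) →
      (∀ (k₁ k₂ : E4 → β) (U V : Set E4), IsOpen V → IsConnected V → IsOpen U → U ⊆ V →
        U.Nonempty → P k₁ V → P k₂ V → EqOn k₁ k₂ U → EqOn k₁ k₂ V) →
      Continuous f → IsOpen D → c₀ ≤ c₁ → 0 < ρ' → 0 < C →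
      (∀ c ∈ Icc c₀ c₁, ∀ x, f x = c → x ∈ closure {y | f y < c}) →
      (∀ c ∈ Icc c₀ c₁, ∀ y ∈ D, c ≤ f y → ∃ x, f x = c ∧ ‖x - y‖ ≤ C * (f y - c)) →
      (∀ c ∈ Icc c₀ c₁, ∀ x, f x = c → ball x ρ ⊆ D) →
      (∀ c ∈ Icc c₀ c₁, ∀ x, f x = c → ∀ k : E4 → β, P k (ball x ρ ∩ {y | f y < c}) →
        ∃ k' : E4 → β, P k' (ball x ρ') ∧ EqOn k' k (ball x ρ' ∩ {y | f y < c})) →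
      P k₀ (D ∩ {y | f y < c₀}) →
      ∃ k : E4 → β, P k (D ∩ {y | f y < c₁}) ∧ EqOn k k₀ (D ∩ {y | f y < c₀}) := by
  intro β P f D c₀ c₁ ρ ρ' C k₀ hmono hcongr hunion hpatch hf hD hc hρ' hC hdense
    hcover hball hloc hk₀
  set σ : ℝ := ρ' / (4 * C) with hσ
  have hσpos : 0 < σ := by positivity
  -- `n` steps of size `σ` starting from `c₀`, as long as the level stays `≤ c₁`
  have key : ∀ n : ℕ, c₀ + n * σ ≤ c₁ →
      ∃ k : E4 → β, P k (D ∩ {y | f y < c₀ + (n + 1) * σ}) ∧ EqOn k k₀ (D ∩ {y | f y < c₀}) := by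
    intro n
    induction n with
    | zero =>
      intro _
      have hc₀ : c₀ ∈ Icc c₀ c₁ := ⟨le_rfl, hc⟩
      obtain ⟨k, hk, hkeq⟩ := levelSweepDense_step β P f D c₀ ρ ρ' C hmono hcongr hunion hpatch
        hf hD hρ' hC (hdense c₀ hc₀) (hcover c₀ hc₀) (hball c₀ hc₀) (hloc c₀ hc₀) k₀ hk₀
      have e : c₀ + ((0 : ℕ) + 1 : ℝ) * σ = c₀ + ρ' / (4 * C) := by
        rw [hσ]; push_cast; ring
      rw [← e] at hk
      exact ⟨k, hk, hkeq⟩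
    | succ n ih =>
      intro hn
      have hn' : c₀ + n * σ ≤ c₁ := by
        have : (n : ℝ) * σ ≤ ((n + 1 : ℕ) : ℝ) * σ := by
          push_cast
          nlinarith
        linarith
      obtain ⟨k, hk, hkeq⟩ := ih hn'
      set c : ℝ := c₀ + (n + 1) * σ with hcdef
      have hcmem : c ∈ Icc c₀ c₁ := by
        refine ⟨?_, ?_⟩
        · rw [hcdef]
          have : (0 : ℝ) ≤ (n + 1) * σ := by positivity
          linarith
        · push_cast at hn
          rw [hcdef]
          exact hn
      obtain ⟨k', hk', hk'eq⟩ := levelSweepDense_step β P f D c ρ ρ' C hmono hcongr hunion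
        hpatch hf hD hρ' hC (hdense c hcmem) (hcover c hcmem) (hball c hcmem) (hloc c hcmem)
        k hk
      refine ⟨k', ?_, fun y hy ↦ ?_⟩
      · have e : c₀ + ((n + 1 : ℕ) + 1 : ℝ) * σ = c + ρ' / (4 * C) := by
          rw [hcdef, hσ]; push_cast; ring
        rw [← e] at hk'
        exact hk'
      · have hy' : y ∈ D ∩ {y | f y < c} := by
          refine ⟨hy.1, ?_⟩
          show f y < c
          have : f y < c₀ := hy.2
          rw [hcdef]
          have : (0 : ℝ) ≤ (n + 1) * σ := by positivity
          linarith
        rw [hk'eq hy', hkeq hy]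
  -- take `n = ⌊(c₁ − c₀)/σ⌋`
  obtain ⟨n, hn₁, hn₂⟩ : ∃ n : ℕ, c₀ + n * σ ≤ c₁ ∧ c₁ ≤ c₀ + (n + 1) * σ := by
    refine ⟨⌊(c₁ - c₀) / σ⌋₊, ?_, ?_⟩
    · have h1 : (⌊(c₁ - c₀) / σ⌋₊ : ℝ) ≤ (c₁ - c₀) / σ :=
        Nat.floor_le (div_nonneg (sub_nonneg.2 hc) hσpos.le)
      have h2 : (⌊(c₁ - c₀) / σ⌋₊ : ℝ) * σ ≤ c₁ - c₀ := by
        rwa [le_div_iff₀ hσpos] at h1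
      linarith
    · have h1 : (c₁ - c₀) / σ < ⌊(c₁ - c₀) / σ⌋₊ + 1 := Nat.lt_floor_add_one _
      have h2 : c₁ - c₀ < (⌊(c₁ - c₀) / σ⌋₊ + 1) * σ := by
        rwa [div_lt_iff₀ hσpos] at h1
      linarith
  obtain ⟨k, hk, hkeq⟩ := key n hn₁
  exact ⟨k, hmono _ _ _ hk fun y hy ↦ ⟨hy.1, lt_of_lt_of_le hy.2 hn₂⟩, hkeq⟩

end Summit.FinalStateConjecture.FinalStateConjecture.Theorems

end
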